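import Mathlib
import Summits.Langlands.Langlands.Theses.DyadicOddResidue
import Literature.NumberTheory.Automorphic.FontaineMazurHilbertTotallySplit
import Literature.NumberTheory.Automorphic.POrdinaryHeckeAlgebraGL2

/-!
# Stub T1′ `ordinarySeedBecomesClassical` of line `ordinary-seed-propagation` — the degenerate case
# (crux `DyadicEisensteinFM`, stmt-Langlands-18741)

Helper file (`--supports`) for the crux
`Summit.Langlands.Langlands.Theses.DyadicOddResidue.DyadicEisensteinFM` (Fontaine–Mazur at `ℓ = 2`
for residually reducible odd regular `ρ : Γ_ℚ → GL₂(ℚ̄₂)`; Paškūnas–Tung 2021, §1.2), line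
`ordinary-seed-propagation` (`Cruxes/DyadicEisensteinFM/Lines/ordinary_seed_propagation.lean`).

Its stub T1′ `stub_ordinarySeedBecomesClassical` says: `ρ` as in the crux and irreducible over
every quadratic field; `F` totally real, Galois over `ℚ`, `2 ∤ d_F`, `2` totally split,
`ρ|_{Γ_F}` irreducible; `(A, D)` an odd Eisenstein `2`-adic `F`-family (compact Hausdorff
Noetherian local DOMAIN `A`, continuous Chenevier determinant `D : PseudoRep2 Γ_F A`, finitely
ramified, `det D(c) = -1`, residually `χ₁ ⊕ χ₂`) through `ρ|_{Γ_F}` (point `x₂`) with an ORDINARY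
SEED `ρ₀` (point `x₀`; irreducible, totally odd, a.e. unramified, irreducible over every quadratic
`K/F`, Borel-shaped on `Γ_{F_w}` for every `w ∣ 2`) ⟹ a field `F′` of the same kind and an odd
Eisenstein `F′`-family through `ρ|_{Γ_{F′}}` carrying a CLASSICAL non-CM point `ρ₁` (attached
a.e., for every `ι : ℚ̄₂ ≃ ℂ`, to a cuspidal `L`-algebraic `π₁` on `GL₂(𝔸_{F′})` with a regular
infinity type).  That is OPEN mathematics at `p = 2` (ordinary Eisenstein `R = 𝕋` over totally
real fields: Skinner–Wiles, Publ. IHÉS 89 (1999) is printed for `p` odd only).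

This file lands its DEGENERATE CASE, which is pure logic and certifies that the typed vocabulary
of the stub composes: if the seed `ρ₀` is ITSELF classical over `F` (attached a.e., for every
`hF`, `ι`, to a regular `L`-algebraic cuspidal `π₀` on `GL₂(𝔸_F)`), the conclusion of T1′ holds
with the witnesses `F′ := F`, `A′ := A`, `D′ := D`, `x₁ := x₀`, `x₂′ := x₂`, `ρ₁ := ρ₀`; the
non-CM clause asked of `ρ₁` is the seed's clause "irreducible over every quadratic `K/F`".
So T1′ is implied by "the given ordinary seed is modular over its own field `F`" — e.g. for `ρ`
ordinary at `2` and already modular, with the constant family.  The statement of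
`ordinarySeedBecomesClassical_of_seedClassical` is VERBATIM the registered stub's `∀/→` chain with
ONE extra antecedent (the last one, "the seed is classical over `F`") inserted before the
conclusion, which is VERBATIM the stub's conclusion (sole textual deviation: `NumberField.discr` is
spelled `discr` under `open NumberField`, twice, to fit the gate's 4000-character limit on the
registered sub-goal signature; the elaborated terms are identical).

No new mathematics; nothing here closes the crux or the stub.
-/

set_option linter.dupNamespace false -- project-wide option (lakefile weak.linter.dupNamespace); `Summit.Langlands.Langlands` is the mandated namespace
set_option linter.overlappingInstances false -- the REGISTERED stub signature binds `[IsDomain A] … [IsLocalRing A]` (both mathematically required: one irreducible component, a local family); the verbatim `∀`-chain copy below must keep them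

namespace Summit.Langlands.Langlands.Theorems.DyadicEisensteinFM

open Summit.Langlands.Langlands.Theses.DyadicOddResidue
open Literature.NumberTheory.Automorphic Literature.NumberTheory.GaloisRepresentations
open Literature.NumberTheory.PAdicHodge
open scoped MatrixGroups
open NumberField IsDedekindDomain Filter Field

/-- **Stub T1′, degenerate case: a classical ordinary seed is already a classical point.**
With the hypotheses of `stub_ordinarySeedBecomesClassical` (line `ordinary-seed-propagation` of
crux `DyadicEisensteinFM`) on `ρ`, `F`, the odd Eisenstein `F`-family `(A, D)` through
`ρ|_{Γ_F}` and its ordinary seed `ρ₀` (verbatim, same order), plus ONE extra antecedent (the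
last): the seed `ρ₀` is attached a.e., for every `hF` and every `ι : ℚ̄₂ ≃+* ℂ`, to a cuspidal
`L`-algebraic `π₀` on `GL₂(𝔸_F)` with a regular infinity type — the stub's conclusion holds,
witnessed by
`F′ = F`, `A′ = A`, `D′ = D`, `x₁ = x₀`, `x₂′ = x₂`, `ρ₁ = ρ₀` (the non-CM clause of `ρ₁` is the
seed's "irreducible over every quadratic `K/F`").  Pure logic. [folklore] -/
theorem ordinarySeedBecomesClassical_of_seedClassical :
  ∀ (ρ : FramedGaloisRep ℚ (PadicAlgCl 2) 2),
    ¬ ρ.IsResiduallyAbsIrreducible → ρ.toGaloisRep.IsIrreducible → ρ.IsOdd →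
    (∀ᶠ v : HeightOneSpectrum (𝓞 ℚ) in cofinite, ρ.IsUnramifiedAt v) →
    (∀ (v : HeightOneSpectrum (𝓞 ℚ)) (hv : ((2 : ℕ) : 𝓞 ℚ) ∈ v.asIdeal),
      (fontainePstAdicCompletion v 2 hv).IsDeRhamFramed (ρ.toLocal v) ∧
      ∀ τ : v.adicCompletion ℚ →+* PadicAlgCl 2, Continuous τ →
        (ρ.labelledHodgeTateWeightsAt v (fontainePstAdicCompletion v 2 hv).algebra
          (fontainePstAdicCompletion v 2 hv).𝔅 τ).Nodup) →
    (∀ (K : Type) [Field K] [NumberField K], Module.finrank ℚ K = 2 →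
      (ρ.restrictField K).toGaloisRep.IsIrreducible) →
    ∀ (F : Type) [Field F] [NumberField F], IsTotallyReal F → IsGalois ℚ F →
    ¬ ((2 : ℤ) ∣ discr F) →
    (∀ w : HeightOneSpectrum (𝓞 F), ((2 : ℕ) : 𝓞 F) ∈ w.asIdeal → w.residueCard = 2) →
    (ρ.restrictField F).toGaloisRep.IsIrreducible →
    ∀ (A : Type) [CommRing A] [IsDomain A] [IsNoetherianRing A] [IsLocalRing A] [TopologicalSpace A]
      [IsTopologicalRing A] [CompactSpace A] [T2Space A]
      (D : PseudoRep2 (absoluteGaloisGroup F) A) (x₀ x₂ : A →+* PadicAlgCl 2)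
      (ρ₀ : FramedGaloisRep F (PadicAlgCl 2) 2),
      (Continuous D.trace ∧
          (∃ S : Set (HeightOneSpectrum (𝓞 F)), S.Finite ∧ ∀ v ∉ S, ∀ 𝔓 ∈ v.primesAbove,
            ∀ σ ∈ 𝔓.inertia (absoluteGaloisGroup F), D.det σ = 1 ∧
              ∀ τ : absoluteGaloisGroup F, D.trace (τ * σ) = D.trace τ) ∧
          (∀ (φ : F →+* ℝ) (c : absoluteGaloisGroup F), IsComplexConjugation φ c →
            ((D.det c : Aˣ) : A) = -1) ∧
          (∃ (k : Type) (_ : Field k) (i : IsLocalRing.ResidueField A →+* k)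
            (χ₁ χ₂ : absoluteGaloisGroup F →* kˣ),
            (D.map (IsLocalRing.residue A)).map i = PseudoRep2.ofCharacters χ₁ χ₂)) →
      (Continuous x₀ ∧ Continuous x₂ ∧ (∀ σ, x₀ (D.trace σ) = (ρ₀ σ).val.trace) ∧
          (∀ σ, x₂ (D.trace σ) = ((ρ.restrictField F) σ).val.trace)) →
      (ρ₀.toGaloisRep.IsIrreducible ∧ ρ₀.IsOdd ∧
          (∀ᶠ w : HeightOneSpectrum (𝓞 F) in cofinite, ρ₀.IsUnramifiedAt w) ∧
          (∀ (K : Type) [Field K] [NumberField K] [Algebra F K], Module.finrank F K = 2 →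
            (ρ₀.restrictField K).toGaloisRep.IsIrreducible) ∧
          ∀ w : HeightOneSpectrum (𝓞 F), ((2 : ℕ) : 𝓞 F) ∈ w.asIdeal →
            ∃ Q : GL (Fin 2) (PadicAlgCl 2), ∀ σ : absoluteGaloisGroup (w.adicCompletion F),
              (Q⁻¹ * ρ₀.toLocal w σ * Q).val 1 0 = 0) →
    (∀ (hF : isCompact_glFiniteIntegralLevel 2 F) (ι : PadicAlgCl 2 ≃+* ℂ),
      ∃ π₀ : CuspidalAutomorphicRepData 2 F hF, π₀.1.IsLAlgebraic ∧
        (∃ T : InfinityType F 2, π₀.1.HasInfinityType T ∧ T.IsRegular) ∧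
        SatakeFrobCompatibleAE ι π₀.1 ρ₀) →
    ∃ (F' : Type) (_ : Field F') (_ : NumberField F'), IsTotallyReal F' ∧ IsGalois ℚ F' ∧
      ¬ ((2 : ℤ) ∣ discr F') ∧
      (∀ w : HeightOneSpectrum (𝓞 F'), ((2 : ℕ) : 𝓞 F') ∈ w.asIdeal → w.residueCard = 2) ∧
      (ρ.restrictField F').toGaloisRep.IsIrreducible ∧
      ∃ (A' : Type) (_ : CommRing A') (_ : IsDomain A') (_ : IsNoetherianRing A') (_ : IsLocalRing A')
        (_ : TopologicalSpace A') (_ : IsTopologicalRing A') (_ : CompactSpace A') (_ : T2Space A')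
        (D' : PseudoRep2 (absoluteGaloisGroup F') A') (x₁ x₂' : A' →+* PadicAlgCl 2)
        (ρ₁ : FramedGaloisRep F' (PadicAlgCl 2) 2),
        (Continuous D'.trace ∧
          (∃ S : Set (HeightOneSpectrum (𝓞 F')), S.Finite ∧ ∀ v ∉ S, ∀ 𝔓 ∈ v.primesAbove,
            ∀ σ ∈ 𝔓.inertia (absoluteGaloisGroup F'), D'.det σ = 1 ∧
              ∀ τ : absoluteGaloisGroup F', D'.trace (τ * σ) = D'.trace τ) ∧
          (∀ (φ : F' →+* ℝ) (c : absoluteGaloisGroup F'), IsComplexConjugation φ c →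
            ((D'.det c : A'ˣ) : A') = -1) ∧
          (∃ (k : Type) (_ : Field k) (i : IsLocalRing.ResidueField A' →+* k)
            (χ₁ χ₂ : absoluteGaloisGroup F' →* kˣ),
            (D'.map (IsLocalRing.residue A')).map i = PseudoRep2.ofCharacters χ₁ χ₂)) ∧
        (Continuous x₁ ∧ Continuous x₂' ∧ (∀ σ, x₁ (D'.trace σ) = (ρ₁ σ).val.trace) ∧
          (∀ σ, x₂' (D'.trace σ) = ((ρ.restrictField F') σ).val.trace)) ∧
        ((∀ (K : Type) [Field K] [NumberField K] [Algebra F' K], Module.finrank F' K = 2 →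
            (ρ₁.restrictField K).toGaloisRep.IsIrreducible) ∧
          (∀ (hF : isCompact_glFiniteIntegralLevel 2 F') (ι : PadicAlgCl 2 ≃+* ℂ),
            ∃ π₁ : CuspidalAutomorphicRepData 2 F' hF, π₁.1.IsLAlgebraic ∧
              (∃ T : InfinityType F' 2, π₁.1.HasInfinityType T ∧ T.IsRegular) ∧
              SatakeFrobCompatibleAE ι π₁.1 ρ₁)) := by
  intro ρ _ _ _ _ _ _ F _ _ hreal hgal hdisc hsplit hirrF A _ _ _ _ _ _ _ _ D x₀ x₂ ρ₀ hfam hpts hseed hclass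
  exact ⟨F, inferInstance, inferInstance, hreal, hgal, hdisc, hsplit, hirrF, A, inferInstance,
    inferInstance, inferInstance, inferInstance, inferInstance, inferInstance, inferInstance,
    inferInstance, D, x₀, x₂, ρ₀, hfam, hpts, hseed.2.2.2.1, hclass⟩

/-- **Stub T1′, second degenerate case: `ρ|_{Γ_F}` itself classical.**  If the point `ρ|_{Γ_F}`
of the odd Eisenstein `F`-family `(A, D)` (point `x₂`) is irreducible over every quadratic `K/F`
and attached a.e., for every `hF`, `ι`, to a regular `L`-algebraic cuspidal `π` on `GL₂(𝔸_F)`,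
then the conclusion of `stub_ordinarySeedBecomesClassical` holds with `F′ = F`, `A′ = A`,
`D′ = D`, `x₁ = x₂′ = x₂`, `ρ₁ = ρ|_{Γ_F}` — no seed is needed.  Records that T1′ (indeed the
whole hypothesis bundle of stub C) is implied by the crux over `F`; pure logic. [folklore] -/
theorem ordinarySeedBecomesClassical_of_restrictClassical
    (ρ : FramedGaloisRep ℚ (PadicAlgCl 2) 2)
    (F : Type) [Field F] [NumberField F] (hreal : IsTotallyReal F) (hgal : IsGalois ℚ F)
    (hdisc : ¬ ((2 : ℤ) ∣ NumberField.discr F))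
    (hsplit : ∀ w : HeightOneSpectrum (𝓞 F), ((2 : ℕ) : 𝓞 F) ∈ w.asIdeal → w.residueCard = 2)
    (hirrF : (ρ.restrictField F).toGaloisRep.IsIrreducible)
    (A : Type) [CommRing A] [IsDomain A] [IsNoetherianRing A] [IsLocalRing A] [TopologicalSpace A]
      [IsTopologicalRing A] [CompactSpace A] [T2Space A]
    (D : PseudoRep2 (absoluteGaloisGroup F) A) (x₂ : A →+* PadicAlgCl 2)
    (hfam : Continuous D.trace ∧
          (∃ S : Set (HeightOneSpectrum (𝓞 F)), S.Finite ∧ ∀ v ∉ S, ∀ 𝔓 ∈ v.primesAbove,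
            ∀ σ ∈ 𝔓.inertia (absoluteGaloisGroup F), D.det σ = 1 ∧
              ∀ τ : absoluteGaloisGroup F, D.trace (τ * σ) = D.trace τ) ∧
          (∀ (φ : F →+* ℝ) (c : absoluteGaloisGroup F), IsComplexConjugation φ c →
            ((D.det c : Aˣ) : A) = -1) ∧
          (∃ (k : Type) (_ : Field k) (i : IsLocalRing.ResidueField A →+* k)
            (χ₁ χ₂ : absoluteGaloisGroup F →* kˣ),
            (D.map (IsLocalRing.residue A)).map i = PseudoRep2.ofCharacters χ₁ χ₂))
    (hx₂ : Continuous x₂ ∧ ∀ σ, x₂ (D.trace σ) = ((ρ.restrictField F) σ).val.trace)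
    (hnCMF : ∀ (K : Type) [Field K] [NumberField K] [Algebra F K], Module.finrank F K = 2 →
      ((ρ.restrictField F).restrictField K).toGaloisRep.IsIrreducible)
    (hclass : ∀ (hF : isCompact_glFiniteIntegralLevel 2 F) (ι : PadicAlgCl 2 ≃+* ℂ),
      ∃ π : CuspidalAutomorphicRepData 2 F hF, π.1.IsLAlgebraic ∧
        (∃ T : InfinityType F 2, π.1.HasInfinityType T ∧ T.IsRegular) ∧
        SatakeFrobCompatibleAE ι π.1 (ρ.restrictField F)) :
    ∃ (F' : Type) (_ : Field F') (_ : NumberField F'), IsTotallyReal F' ∧ IsGalois ℚ F' ∧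
      ¬ ((2 : ℤ) ∣ NumberField.discr F') ∧
      (∀ w : HeightOneSpectrum (𝓞 F'), ((2 : ℕ) : 𝓞 F') ∈ w.asIdeal → w.residueCard = 2) ∧
      (ρ.restrictField F').toGaloisRep.IsIrreducible ∧
      ∃ (A' : Type) (_ : CommRing A') (_ : IsDomain A') (_ : IsNoetherianRing A') (_ : IsLocalRing A')
        (_ : TopologicalSpace A') (_ : IsTopologicalRing A') (_ : CompactSpace A') (_ : T2Space A')
        (D' : PseudoRep2 (absoluteGaloisGroup F') A') (x₁ x₂' : A' →+* PadicAlgCl 2)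
        (ρ₁ : FramedGaloisRep F' (PadicAlgCl 2) 2),
        (Continuous D'.trace ∧
          (∃ S : Set (HeightOneSpectrum (𝓞 F')), S.Finite ∧ ∀ v ∉ S, ∀ 𝔓 ∈ v.primesAbove,
            ∀ σ ∈ 𝔓.inertia (absoluteGaloisGroup F'), D'.det σ = 1 ∧
              ∀ τ : absoluteGaloisGroup F', D'.trace (τ * σ) = D'.trace τ) ∧
          (∀ (φ : F' →+* ℝ) (c : absoluteGaloisGroup F'), IsComplexConjugation φ c →
            ((D'.det c : A'ˣ) : A') = -1) ∧
          (∃ (k : Type) (_ : Field k) (i : IsLocalRing.ResidueField A' →+* k)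
            (χ₁ χ₂ : absoluteGaloisGroup F' →* kˣ),
            (D'.map (IsLocalRing.residue A')).map i = PseudoRep2.ofCharacters χ₁ χ₂)) ∧
        (Continuous x₁ ∧ Continuous x₂' ∧ (∀ σ, x₁ (D'.trace σ) = (ρ₁ σ).val.trace) ∧
          (∀ σ, x₂' (D'.trace σ) = ((ρ.restrictField F') σ).val.trace)) ∧
        ((∀ (K : Type) [Field K] [NumberField K] [Algebra F' K], Module.finrank F' K = 2 →
            (ρ₁.restrictField K).toGaloisRep.IsIrreducible) ∧
          (∀ (hF : isCompact_glFiniteIntegralLevel 2 F') (ι : PadicAlgCl 2 ≃+* ℂ),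
            ∃ π₁ : CuspidalAutomorphicRepData 2 F' hF, π₁.1.IsLAlgebraic ∧
              (∃ T : InfinityType F' 2, π₁.1.HasInfinityType T ∧ T.IsRegular) ∧
              SatakeFrobCompatibleAE ι π₁.1 ρ₁)) :=
  ⟨F, inferInstance, inferInstance, hreal, hgal, hdisc, hsplit, hirrF, A, inferInstance, inferInstance,
    inferInstance, inferInstance, inferInstance, inferInstance, inferInstance, inferInstance, D, x₂, x₂,
    ρ.restrictField F, hfam, ⟨hx₂.1, hx₂.1, hx₂.2, hx₂.2⟩, hnCMF, hclass⟩

end Summit.Langlands.Langlands.Theorems.DyadicEisensteinFM
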